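import Summits.QuantumFields.YangMills.Theorems.FluctuationComparisonRegPrIntLS2BetaSignedComb
import HarnessLib

/-!
# (C3-c) II — the COMB SET of the signed in-block comb: the tree-gauge axioms `hkill` and `hloc`

Crux `stmt-QuantumFields-20520` (`…Theses.UnitScaleTilt.FluctuationComparisonRegPrIntL`), LINE g18-1 S2β LAPLACE, organ (C3)
«tubular Haar coordinates around a residual-gauge orbit».  Part I (`…S2BetaSignedComb`) built the SIGNED comb transporter
`combTransporter k U x` = the holonomy of `U` along the coordinate-ordered signed path from the centre of the `k`-block of `x` to `x`,
and proved the tree-gauge axioms `hg1`, `hgR`, `hcov` and continuity.  This file supplies the two remaining axioms of the generic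
tree-gauge chart `…S2BetaTreeGaugeChart.exists_tubularChart_of_treeGauge` (p736010):

* the COMB SET `combSet k` — the bonds `⟨y, μ⟩` lying inside one `k`-block (`blockIter k y = blockIter k (y + e_μ)`) whose source has
  its LATER coordinates `ν > μ` still at the block centre; these are exactly the bonds the signed comb paths use;
* `hkill` (`combTransporter_kill`): `g_U(b₋) · U(b) · g_U(b₊)⁻¹ = 1` for `b ∈ combSet k` — the comb path to the far end of a comb bond is
  the comb path to its near end followed by the bond (uniform signed-step identity `lineHolZ_add_one`, no sign split);
* `hloc` (`combTransporter_congr`): `g_U` depends only on `U|comb` — every bond of a comb path is a comb bond (block arithmetic: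
  `val_rootOf`, the signed offset bound `|x_μ − root_μ| ≤ (Lᵏ−1)/2`, and no wrap-around inside a block, `val_rootOf_add_le`);
* the OFF-PIVOT FREENESS letter (`eq_one_of_isResidual_of_gaugeAct_eq_on_combSet`): a residual gauge transformation (`= 1` at the
  `k`-centres) fixing `U` on the comb bonds is trivial — the `σ`-side half of the stabiliser statement `hstab` asked for by
  w5-20520 ∕ px11 (their `pivotAct_eq_self_iff` is the group half).

Bookkeeping only (Bałaban's «averaging over gauge orbits ∕ axial-type gauge in blocks», [Balaban1985Averaging] (8) p.19,
[Balaban1985Variational] (19) p.281, (181) p.307); nothing printed is asserted as a fact.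
-/

open Function
open Literature.MathematicalPhysics.QuantumFieldTheory.Balaban1983to89
open Literature.MathematicalPhysics.QuantumFieldTheory.Balaban1983to89.T4RootedResidualGauge
  (shiftN shiftN_zero lineHol lineHol_succ rootOf rootOf_embIter blockIter_rootOf)
open Literature.MathematicalPhysics.QuantumFieldTheory.Balaban1983to89.B15DeterminingSets (embIter)
open Literature.MathematicalPhysics.QuantumFieldTheory.Balaban1983to89.B14.Eq22Determines (blockIter blockIter_zero blockIter_succ)
open Literature.MathematicalPhysics.QuantumFieldTheory.Balaban1983to89.B15Eq177GaugeInvariance (blockIter_embIter)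
open Literature.MathematicalPhysics.QuantumFieldTheory.Balaban1983to89.GaugeField (gaugeAct)
open Summit.QuantumFields.YangMills.Theorems.FluctuationComparisonRegPrIntLS2BetaSignedComb

namespace Summit.QuantumFields.YangMills.Theorems.FluctuationComparisonRegPrIntLS2BetaSignedCombKill

variable {P : Params} {j : ℕ} {G : Type*} [GaugeGroup G]

/-! ## §1  Signed lines: one more step, agreement, dependence on the bonds traversed -/

/-- `lineHolZ (−n) = lineHolBack n` (including `n = 0`). [cite: Balaban1985Averaging, (8) p.19 (bookkeeping)] -/
theorem lineHolZ_neg_natCast (U : GaugeField P j G) (a : Site P j) (μ : Fin P.d) :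
    ∀ n : ℕ, lineHolZ U a μ (-(n : ℤ)) = lineHolBack U a μ n
  | 0 => by rw [Nat.cast_zero, neg_zero, lineHolZ_zero, lineHolBack_zero]
  | n + 1 => by
      rw [show (-((n + 1 : ℕ) : ℤ)) = Int.negSucc n by rw [Int.negSucc_eq]; push_cast; ring, lineHolZ_negSucc]

/-- ★ THE UNIFORM SIGNED STEP: `hol(a → a + (n+1)e_μ) = hol(a → a + n e_μ) · U⟨a + n e_μ, μ⟩` for EVERY `n ∈ ℤ` (forward: one more bond;
backward: one fewer inverted bond). [cite: Balaban1985Averaging, (8) p.19 (bookkeeping)] -/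
theorem lineHolZ_add_one (U : GaugeField P j G) (a : Site P j) (μ : Fin P.d) :
    ∀ n : ℤ, lineHolZ U a μ (n + 1) = lineHolZ U a μ n * U ⟨shiftZ a μ n, μ⟩
  | Int.ofNat n => by
      rw [show (Int.ofNat n : ℤ) = (n : ℤ) from rfl, show (n : ℤ) + 1 = ((n + 1 : ℕ) : ℤ) by push_cast; rfl,
        lineHolZ_natCast, lineHolZ_natCast, lineHol_succ, shiftZ_natCast]
  | Int.negSucc n => by
      rw [show (Int.negSucc n : ℤ) + 1 = -(n : ℤ) by rw [Int.negSucc_eq]; ring, lineHolZ_neg_natCast, lineHolZ_negSucc,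
        lineHolBack_succ, Int.negSucc_eq, mul_assoc, inv_mul_cancel, mul_one]

/-- One signed segment, unfolded. [cite: Balaban1985Averaging, (8) p.19 (bookkeeping)] -/
theorem pathHolZ_cons (U : GaugeField P j G) (a x : Site P j) (μ : Fin P.d) (l : List (Fin P.d)) :
    pathHolZ U a x (μ :: l) = lineHolZ U a μ (((x μ).val : ℤ) - ((a μ).val : ℤ)) *
      pathHolZ U (shiftZ a μ (((x μ).val : ℤ) - ((a μ).val : ℤ))) x l := rfl

/-- A signed path whose base already agrees with its target on the listed directions is trivial. [cite: Balaban1985Averaging, (8) p.19 (bookkeeping)] -/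
theorem pathHolZ_eq_one_of_agree (U : GaugeField P j G) :
    ∀ (a x : Site P j) (l : List (Fin P.d)), (∀ ν ∈ l, x ν = a ν) → pathHolZ U a x l = 1
  | _, _, [], _ => rfl
  | a, x, μ :: l, h => by
      have hμ : ((x μ).val : ℤ) - ((a μ).val : ℤ) = 0 := by rw [h μ List.mem_cons_self, sub_self]
      rw [pathHolZ_cons, hμ, lineHolZ_zero, shiftZ_zero, one_mul]
      exact pathHolZ_eq_one_of_agree U a x l fun ν hν => h ν (List.mem_cons_of_mem _ hν)

/-- A forward line holonomy depends only on the bonds `⟨a + i e_μ, μ⟩`, `0 ≤ i < n`. [cite: Balaban1985Averaging, (8) p.19 (bookkeeping)] -/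
theorem lineHol_congr {U U' : GaugeField P j G} (a : Site P j) (μ : Fin P.d) :
    ∀ n : ℕ, (∀ i : ℕ, i < n → U ⟨shiftZ a μ (i : ℤ), μ⟩ = U' ⟨shiftZ a μ (i : ℤ), μ⟩) → lineHol U a μ n = lineHol U' a μ n
  | 0, _ => rfl
  | n + 1, h => by
      rw [lineHol_succ, lineHol_succ, lineHol_congr a μ n fun i hi => h i (Nat.lt_succ_of_lt hi), ← shiftZ_natCast,
        h n (Nat.lt_succ_self n)]

/-- A backward line holonomy depends only on the bonds `⟨a − (i+1) e_μ, μ⟩`, `0 ≤ i < n`. [cite: Balaban1985Averaging, (8) p.19 (bookkeeping)] -/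
theorem lineHolBack_congr {U U' : GaugeField P j G} (a : Site P j) (μ : Fin P.d) :
    ∀ n : ℕ, (∀ i : ℕ, i < n → U ⟨shiftZ a μ (-((i : ℤ) + 1)), μ⟩ = U' ⟨shiftZ a μ (-((i : ℤ) + 1)), μ⟩) →
      lineHolBack U a μ n = lineHolBack U' a μ n
  | 0, _ => rfl
  | n + 1, h => by
      rw [lineHolBack_succ, lineHolBack_succ, lineHolBack_congr a μ n fun i hi => h i (Nat.lt_succ_of_lt hi),
        h n (Nat.lt_succ_self n)]

/-- A SIGNED line holonomy by `n` steps depends only on the bonds `⟨a + t e_μ, μ⟩`, `min n 0 ≤ t < max n 0`.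
[cite: Balaban1985Averaging, (8) p.19 (bookkeeping)] -/
theorem lineHolZ_congr {U U' : GaugeField P j G} (a : Site P j) (μ : Fin P.d) :
    ∀ n : ℤ, (∀ t : ℤ, min n 0 ≤ t → t < max n 0 → U ⟨shiftZ a μ t, μ⟩ = U' ⟨shiftZ a μ t, μ⟩) →
      lineHolZ U a μ n = lineHolZ U' a μ n
  | Int.ofNat n, h => by
      rw [show (Int.ofNat n : ℤ) = (n : ℤ) from rfl, lineHolZ_natCast, lineHolZ_natCast]
      refine lineHol_congr a μ n fun i hi => h i ?_ ?_
      · exact (min_le_right _ _).trans (Int.natCast_nonneg i)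
      · exact lt_max_of_lt_left (show (i : ℤ) < (n : ℤ) by exact_mod_cast hi)
  | Int.negSucc n, h => by
      rw [lineHolZ_negSucc, lineHolZ_negSucc]
      refine lineHolBack_congr a μ (n + 1) fun i hi => h _ ?_ ?_
      · rw [Int.negSucc_eq]; exact (min_le_left _ _).trans (by omega)
      · exact lt_max_of_lt_right (by omega)

/-! ## §2  `hkill`, combinatorial core: the path to `y + e_μ` is the path to `y` followed by `⟨y, μ⟩`

For an increasing list of directions `l ∋ μ`, a base `a` agreeing with `y` off `l`, and a target `y` whose `l`-coordinates AFTER `μ`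
are already those of `a` (so the path makes no move after the `μ`-segment), provided the step `y_μ ↦ y_μ + 1` does not wrap around
the torus. -/

/-- ★ The signed path to `y + e_μ` equals the signed path to `y` times the bond variable `U⟨y, μ⟩`. [cite: Balaban1985Averaging, (8) p.19 (bookkeeping)] -/
theorem pathHolZ_shift_eq (U : GaugeField P j G) (y : Site P j) (μ : Fin P.d)
    (hwrap : (((y.shift μ) μ).val : ℤ) = ((y μ).val : ℤ) + 1) :
    ∀ (l : List (Fin P.d)) (a : Site P j), l.Pairwise (· < ·) → μ ∈ l → (∀ ν, ν ∉ l → a ν = y ν) →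
      (∀ ν ∈ l, μ < ν → y ν = a ν) → pathHolZ U a (y.shift μ) l = pathHolZ U a y l * U ⟨y, μ⟩
  | [], _, _, hμ, _, _ => absurd hμ List.not_mem_nil
  | ν₀ :: l, a, hsort, hμ, hout, hlater => by
      rw [List.pairwise_cons] at hsort
      rw [pathHolZ_cons, pathHolZ_cons]
      by_cases h0 : ν₀ = μ
      · subst h0
        have hval : ((((y.shift ν₀) ν₀).val : ℤ) - ((a ν₀).val : ℤ)) = (((y ν₀).val : ℤ) - ((a ν₀).val : ℤ)) + 1 := by
          rw [hwrap]; ring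
        rw [hval, lineHolZ_add_one]
        -- the point reached after the `ν₀`-segment aimed at `y` IS `y`
        have hend : shiftZ a ν₀ (((y ν₀).val : ℤ) - ((a ν₀).val : ℤ)) = y := by
          funext ν
          rw [shiftZ_steps_apply]
          by_cases hν : ν = ν₀
          · rw [if_pos hν, hν]
          · rw [if_neg hν]
            by_cases hνl : ν ∈ l
            · exact (hlater ν (List.mem_cons_of_mem _ hνl) (hsort.1 ν hνl)).symm
            · exact hout ν (by simp [hν, hνl])
        rw [hend]
        -- both tails are trivial
        have ht1 : pathHolZ U (shiftZ a ν₀ ((((y ν₀).val : ℤ) - ((a ν₀).val : ℤ)) + 1)) (y.shift ν₀) l = 1 := by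
          refine pathHolZ_eq_one_of_agree U _ _ l fun ν hν => ?_
          have hne : ν ≠ ν₀ := (hsort.1 ν hν).ne'
          rw [shiftZ_apply_of_ne _ hne]
          show Function.update y ν₀ (y ν₀ + 1) ν = a ν
          rw [Function.update_of_ne hne]
          exact hlater ν (List.mem_cons_of_mem _ hν) (hsort.1 ν hν)
        rw [ht1, pathHolZ_self, mul_one, mul_one]
      · -- `ν₀ ≠ μ`: identical first segments, then the induction hypothesis from the new base
        have hsame : (y.shift μ) ν₀ = y ν₀ := by
          show Function.update y μ (y μ + 1) ν₀ = y ν₀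
          rw [Function.update_of_ne h0]
        rw [hsame]
        have hμl : μ ∈ l := by
          rcases List.mem_cons.1 hμ with h | h
          · exact absurd h.symm h0
          · exact h
        rw [pathHolZ_shift_eq U y μ hwrap l _ hsort.2 hμl ?_ ?_, mul_assoc]
        · intro ν hν
          rw [shiftZ_steps_apply]
          by_cases hν0 : ν = ν₀
          · rw [if_pos hν0, hν0]
          · rw [if_neg hν0]
            exact hout ν (by simp [hν0, hν])
        · intro ν hν hlt
          rw [shiftZ_apply_of_ne _ (hsort.1 ν hν).ne']
          exact hlater ν (List.mem_cons_of_mem _ hν) hlt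

/-! ## §3  Block arithmetic at level `0` (standing range `k ≤ m + K`) -/

section Blocks

variable {k : ℕ}

omit [GaugeGroup G] in
/-- `(Bᵏ x)_μ = x_μ / Lᵏ` (label arithmetic of `Setup.blockOf`). [cite: Balaban1987RG1, (0.1) p.251] -/
theorem val_blockIter : ∀ {k : ℕ}, k ≤ P.m + P.K → ∀ (x : Site P 0) (μ : Fin P.d), ((blockIter k x) μ).val = (x μ).val / P.L ^ k
  | 0, _, x, μ => by simp
  | k + 1, hk, x, μ => by
      rw [blockIter_succ, Site.val_blockOf (by omega), val_blockIter (by omega), Nat.div_div_eq_div_mul, pow_succ]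

omit [GaugeGroup G] in
/-- `(L−1)/2·Lⁿ + (Lⁿ−1)/2 = (L^{n+1}−1)/2` for odd `L`. [cite: Balaban1987RG1, (0.1) p.252 (bookkeeping)] -/
private theorem half_pred_mul_pow_add {L : ℕ} (hLo : Odd L) (n : ℕ) :
    (L - 1) / 2 * L ^ n + (L ^ n - 1) / 2 = (L ^ (n + 1) - 1) / 2 := by
  obtain ⟨a, rfl⟩ := hLo
  obtain ⟨b, hb⟩ := ((odd_two_mul_add_one a).pow : Odd ((2 * a + 1) ^ n))
  rw [pow_succ, hb]
  have h3 : (2 * b + 1) * (2 * a + 1) = 2 * (a * (2 * b + 1) + b) + 1 := by ring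
  have h1 : (2 * a + 1 - 1) / 2 = a := by omega
  rw [h3, h1]
  generalize a * (2 * b + 1) = p
  omega

omit [GaugeGroup G] in
/-- `(ιᵏ y)_μ = y_μ·Lᵏ + (Lᵏ−1)/2` (centre convention, `L` odd). [cite: Balaban1987RG1, (0.1) pp.251–252] -/
theorem val_embIter : ∀ {k : ℕ}, k ≤ P.m + P.K → ∀ (y : Site P k) (μ : Fin P.d),
    ((embIter k y) μ).val = (y μ).val * P.L ^ k + (P.L ^ k - 1) / 2
  | 0, _, y, μ => by simp [embIter]
  | k + 1, hk, y, μ => by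
      show ((embIter k (emb y)) μ).val = _
      rw [val_embIter (by omega) (emb y) μ, Site.val_emb (by omega) y μ, add_mul, mul_assoc, ← pow_succ', add_assoc,
        half_pred_mul_pow_add P.hL.1 k]

omit [GaugeGroup G] in
/-- THE ROOT'S LABEL: `(root x)_μ = (x_μ / Lᵏ)·Lᵏ + (Lᵏ−1)/2`, the centre of the `Lᵏ`-range containing `x_μ`. [cite: Balaban1987RG1, (0.1) pp.251–252] -/
theorem val_rootOf (hk : k ≤ P.m + P.K) (x : Site P 0) (μ : Fin P.d) :
    ((rootOf k x) μ).val = (x μ).val / P.L ^ k * P.L ^ k + (P.L ^ k - 1) / 2 := by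
  show ((embIter k (blockIter k x)) μ).val = _
  rw [val_embIter hk, val_blockIter hk]

omit [GaugeGroup G] in
/-- THE SIGNED OFFSET BOUND: `|x_μ − (root x)_μ| ≤ (Lᵏ−1)/2` (two `ℕ` inequalities). [cite: Balaban1987RG1, (0.1) pp.251–252] -/
theorem val_rootOf_le (hk : k ≤ P.m + P.K) (x : Site P 0) (μ : Fin P.d) :
    (rootOf k x μ).val ≤ (x μ).val + (P.L ^ k - 1) / 2 ∧ (x μ).val ≤ (rootOf k x μ).val + (P.L ^ k - 1) / 2 := by
  rw [val_rootOf hk]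
  obtain ⟨c, hc⟩ : Odd (P.L ^ k) := P.hL.1.pow
  have h1 : P.L ^ k * ((x μ).val / P.L ^ k) + (x μ).val % P.L ^ k = (x μ).val := Nat.div_add_mod _ _
  have h2 : (x μ).val % P.L ^ k < P.L ^ k := Nat.mod_lt _ (pow_pos P.L_pos k)
  rw [mul_comm]
  generalize P.L ^ k * ((x μ).val / P.L ^ k) = p at h1 ⊢
  generalize (x μ).val % P.L ^ k = r at h1 h2
  generalize P.L ^ k = M at hc h2 ⊢
  omega

omit [GaugeGroup G] in
/-- `N = Lᵏ · 2L^{m+K−k}`: the `k`-blocks tile each direction of `T_η` exactly. [cite: Balaban1987RG1, (0.1) p.251] -/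
theorem sitesPerDir_zero_eq (hk : k ≤ P.m + P.K) : P.sitesPerDir 0 = P.L ^ k * (2 * P.L ^ (P.m + P.K - k)) := by
  unfold Params.sitesPerDir
  rw [Nat.sub_zero, mul_left_comm, ← pow_add, Nat.add_sub_cancel' hk]

omit [GaugeGroup G] in
/-- NO WRAP-AROUND INSIDE A BLOCK: moving the root's `μ`-label by `t`, `|t| ≤ (Lᵏ−1)/2`, stays inside `[0, N)` and inside the same
`Lᵏ`-range: the new label is `(root x)_μ + t` and its block index is that of `x`. [cite: Balaban1987RG1, (0.1) pp.251–252] -/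
theorem val_rootOf_add (hk : k ≤ P.m + P.K) (x : Site P 0) (μ : Fin P.d) {t : ℤ}
    (ht₁ : -(((P.L ^ k - 1) / 2 : ℕ) : ℤ) ≤ t) (ht₂ : t ≤ (((P.L ^ k - 1) / 2 : ℕ) : ℤ)) :
    (((rootOf k x μ + (t : ZMod (P.sitesPerDir 0))).val : ℤ)) = ((rootOf k x μ).val : ℤ) + t ∧
      (rootOf k x μ + (t : ZMod (P.sitesPerDir 0))).val / P.L ^ k = (x μ).val / P.L ^ k := by
  obtain ⟨c, hc⟩ : Odd (P.L ^ k) := P.hL.1.pow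
  have hh : (P.L ^ k - 1) / 2 = c := by omega
  rw [hh] at ht₁ ht₂
  -- `t = s − c` with `s ≤ 2c`
  obtain ⟨s, hs⟩ := Int.eq_ofNat_of_zero_le (a := t + c) (by omega)
  have hs' : t = (s : ℤ) - c := by omega
  have hsc : s ≤ 2 * c := by omega
  have hr : (rootOf k x μ).val = (x μ).val / P.L ^ k * P.L ^ k + c := by rw [val_rootOf hk, hh]
  have hN := sitesPerDir_zero_eq (P := P) hk
  have hx : (x μ).val < P.sitesPerDir 0 := ZMod.val_lt _
  -- `(q+1)·Lᵏ ≤ N`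
  have hq : (x μ).val / P.L ^ k * P.L ^ k + P.L ^ k ≤ P.sitesPerDir 0 := by
    have hlt : (x μ).val / P.L ^ k < 2 * P.L ^ (P.m + P.K - k) := by
      rw [Nat.div_lt_iff_lt_mul (pow_pos P.L_pos k), mul_comm, ← hN]; exact hx
    calc (x μ).val / P.L ^ k * P.L ^ k + P.L ^ k = P.L ^ k * ((x μ).val / P.L ^ k + 1) := by ring
      _ ≤ P.L ^ k * (2 * P.L ^ (P.m + P.K - k)) := Nat.mul_le_mul_left _ hlt
      _ = P.sitesPerDir 0 := hN.symm
  have hlt : (x μ).val / P.L ^ k * P.L ^ k + s < P.sitesPerDir 0 := by omega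
  -- the moved label is the natural number `q·Lᵏ + s < N`
  have hcast : rootOf k x μ + (t : ZMod (P.sitesPerDir 0)) = (((x μ).val / P.L ^ k * P.L ^ k + s : ℕ) : ZMod (P.sitesPerDir 0)) := by
    rw [← ZMod.natCast_zmod_val (rootOf k x μ), hr, hs']
    push_cast
    ring
  have hval : (rootOf k x μ + (t : ZMod (P.sitesPerDir 0))).val = (x μ).val / P.L ^ k * P.L ^ k + s := by
    rw [hcast, ZMod.val_natCast, Nat.mod_eq_of_lt hlt]
  refine ⟨?_, ?_⟩
  · rw [hval, hr, hs']; push_cast; ring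
  · rw [hval]
    exact Nat.div_eq_of_lt_le (by omega) (by rw [Nat.succ_mul]; omega)

omit [GaugeGroup G] in
/-- Two fine sites have the same `k`-block iff their labels have the same `Lᵏ`-quotients. [cite: Balaban1987RG1, (0.1) p.251] -/
theorem blockIter_eq_iff (hk : k ≤ P.m + P.K) (z z' : Site P 0) :
    blockIter k z = blockIter k z' ↔ ∀ ν, (z ν).val / P.L ^ k = (z' ν).val / P.L ^ k := by
  constructor
  · intro h ν; rw [← val_blockIter hk, ← val_blockIter hk, h]
  · intro h; funext ν; apply ZMod.val_injective; rw [val_blockIter hk, val_blockIter hk, h ν]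

omit [GaugeGroup G] in
/-- Same block ⇒ same root. [cite: Balaban1987RG1, (0.1) p.251] -/
theorem rootOf_eq_of_blockIter_eq {z z' : Site P 0} (h : blockIter k z = blockIter k z') : rootOf k z = rootOf k z' := by
  show embIter k (blockIter k z) = embIter k (blockIter k z'); rw [h]

omit [GaugeGroup G] in
/-- NO WRAP ACROSS A COMB BOND: if `y` and `y + e_μ` lie in one `k`-block then the label of `y + e_μ` is `y_μ + 1`. [cite: Balaban1987RG1, (0.1) p.251] -/
theorem val_shift_of_blockIter_eq (hk : k ≤ P.m + P.K) {y : Site P 0} {μ : Fin P.d}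
    (h : blockIter k y = blockIter k (y.shift μ)) : (((y.shift μ) μ).val : ℤ) = ((y μ).val : ℤ) + 1 := by
  have hN := sitesPerDir_zero_eq (P := P) hk
  have hμ := (blockIter_eq_iff hk _ _).1 h μ
  have hs : (y.shift μ) μ = y μ + 1 := by simp [Site.shift]
  rw [hs] at hμ ⊢
  have hv : (y μ + 1).val = ((y μ).val + 1) % P.sitesPerDir 0 := by
    rw [ZMod.val_add, ZMod.val_one_eq_one_mod, Nat.add_mod_mod]
  have hy : (y μ).val < P.sitesPerDir 0 := ZMod.val_lt _
  rcases Nat.lt_or_ge ((y μ).val + 1) (P.sitesPerDir 0) with hlt | hge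
  · rw [hv, Nat.mod_eq_of_lt hlt]; push_cast; ring
  · exfalso
    have hE : (y μ).val + 1 = P.sitesPerDir 0 := le_antisymm hy hge
    rw [hv, hE, Nat.mod_self, Nat.zero_div] at hμ
    -- `y_μ = N − 1 ≥ Lᵏ`, so its block index is `≥ 1`
    have hL1 : 1 ≤ P.L ^ (P.m + P.K - k) := Nat.one_le_pow _ _ P.L_pos
    have hge' : P.L ^ k ≤ (y μ).val := by
      have : P.L ^ k * 2 ≤ P.sitesPerDir 0 := by rw [hN]; exact Nat.mul_le_mul_left _ (by omega)
      omega
    have := Nat.div_pos hge' (pow_pos P.L_pos k)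
    omega

end Blocks

/-! ## §4  The comb set; `hkill`; `hloc`; off-pivot freeness -/

/-- **THE COMB SET** of level `k`: the bonds `⟨y, μ⟩` inside one `k`-block whose source has its later coordinates `ν > μ` at the block centre —
exactly the bonds traversed by the signed comb paths of `combTransporter k`. [cite: Balaban1985Variational, (19) p.281; Balaban1985RegularSpaces, (1.19) p.24] -/
def combSet (k : ℕ) : Set (PBond P 0) :=
  {b | blockIter k b.src = blockIter k b.tgt ∧ ∀ ν, b.dir < ν → b.src ν = rootOf k b.src ν}

omit [GaugeGroup G] in
/-- Membership in the comb set, unfolded. [cite: Balaban1985Variational, (19) p.281 (bookkeeping)] -/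
theorem mem_combSet {k : ℕ} {b : PBond P 0} :
    b ∈ (combSet k : Set (PBond P 0)) ↔ blockIter k b.src = blockIter k b.tgt ∧ ∀ ν, b.dir < ν → b.src ν = rootOf k b.src ν := Iff.rfl

/-- ★★ `hkill`: THE TREE GAUGE KILLS THE COMB — `g_U(b₋) · U(b) · g_U(b₊)⁻¹ = 1` for every comb bond `b`. [cite: Balaban1985Variational, (19) p.281; Balaban1985Averaging, (8) p.19] -/
theorem combTransporter_kill {k : ℕ} (hk : k ≤ P.m + P.K) (U : GaugeField P 0 G) {b : PBond P 0} (hb : b ∈ (combSet k : Set (PBond P 0))) :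
    combTransporter k U b.src * U b * (combTransporter k U b.tgt)⁻¹ = 1 := by
  have htgt : combTransporter k U b.tgt = combTransporter k U b.src * U b := by
    unfold combTransporter
    rw [← rootOf_eq_of_blockIter_eq hb.1]
    exact pathHolZ_shift_eq U b.src b.dir (val_shift_of_blockIter_eq hk hb.1) (List.finRange P.d) (rootOf k b.src)
      (List.pairwise_lt_finRange P.d) (List.mem_finRange _) (fun ν hν => absurd (List.mem_finRange ν) hν)
      (fun ν _ hlt => hb.2 ν hlt)
  rw [htgt, mul_inv_cancel]

/-- `hloc`, combinatorial core: along an upward-closed increasing list of pending directions, from a base inside the block of `x` whose pending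
coordinates are the root's, the signed path aimed at `x` only traverses comb bonds. [cite: Balaban1985Variational, (19) p.281 (bookkeeping)] -/
theorem pathHolZ_congr_of_eqOn_combSet {k : ℕ} (hk : k ≤ P.m + P.K) {U U' : GaugeField P 0 G}
    (h : ∀ b ∈ (combSet k : Set (PBond P 0)), U b = U' b) (x : Site P 0) :
    ∀ (l : List (Fin P.d)) (a : Site P 0), l.Pairwise (· < ·) → (∀ ν₀ ∈ l, ∀ ν, ν₀ < ν → ν ∈ l) →
      blockIter k a = blockIter k x → (∀ ν ∈ l, a ν = rootOf k x ν) → pathHolZ U a x l = pathHolZ U' a x l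
  | [], _, _, _, _, _ => rfl
  | ν₀ :: l, a, hsort, hup, hblk, hroot => by
      rw [List.pairwise_cons] at hsort
      rw [pathHolZ_cons, pathHolZ_cons]
      have ha0 : a ν₀ = rootOf k x ν₀ := hroot ν₀ List.mem_cons_self
      have hoff := val_rootOf_le hk x ν₀
      have hxa : ∀ ν, (a ν).val / P.L ^ k = (x ν).val / P.L ^ k := fun ν => ((blockIter_eq_iff hk a x).1 hblk ν)
      -- a point of the `ν₀`-segment: `a` with its `ν₀`-label moved by `t`, `|t| ≤ (Lᵏ−1)/2`, is in the block of `x`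
      have hseg : ∀ t : ℤ, -(((P.L ^ k - 1) / 2 : ℕ) : ℤ) ≤ t → t ≤ (((P.L ^ k - 1) / 2 : ℕ) : ℤ) →
          blockIter k (shiftZ a ν₀ t) = blockIter k x := by
        intro t ht₁ ht₂
        rw [blockIter_eq_iff hk]
        intro ν
        by_cases hν : ν = ν₀
        · subst hν; rw [shiftZ_apply_self, ha0]; exact (val_rootOf_add hk x ν ht₁ ht₂).2
        · rw [shiftZ_apply_of_ne _ hν]; exact hxa ν
      -- the segment's bonds are comb bonds
      have hline : lineHolZ U a ν₀ (((x ν₀).val : ℤ) - ((a ν₀).val : ℤ)) = lineHolZ U' a ν₀ (((x ν₀).val : ℤ) - ((a ν₀).val : ℤ)) := by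
        refine lineHolZ_congr a ν₀ _ fun t ht₁ ht₂ => h _ ⟨?_, ?_⟩
        · -- both endpoints in the block of `x`
          have hs : (⟨shiftZ a ν₀ t, ν₀⟩ : PBond P 0).tgt = shiftZ a ν₀ (t + 1) := by
            show Site.shift (shiftZ a ν₀ t) ν₀ = shiftZ a ν₀ (t + 1)
            simp only [Site.shift, shiftZ, Function.update_idem, Function.update_self]
            congr 1; push_cast; ring
          rw [hs, hseg t (by rw [ha0] at ht₁; omega) (by rw [ha0] at ht₂; omega),
            hseg (t + 1) (by rw [ha0] at ht₁; omega) (by rw [ha0] at ht₂; omega)]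
        · intro ν hlt
          have hne : ν ≠ ν₀ := hlt.ne'
          show shiftZ a ν₀ t ν = rootOf k (shiftZ a ν₀ t) ν
          rw [rootOf_eq_of_blockIter_eq (hseg t (by rw [ha0] at ht₁; omega) (by rw [ha0] at ht₂; omega)),
            shiftZ_apply_of_ne _ hne]
          exact hroot ν (hup ν₀ List.mem_cons_self ν hlt)
      rw [hline, pathHolZ_congr_of_eqOn_combSet hk h x l _ hsort.2 ?_ ?_ ?_]
      · intro ν₁ hν₁ ν hlt
        exact (List.mem_cons.1 (hup ν₁ (List.mem_cons_of_mem _ hν₁) ν hlt)).resolve_left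
          (fun hνe => (lt_asymm (hsort.1 ν₁ hν₁)) (hνe ▸ hlt))
      · exact hseg _ (by rw [ha0]; omega) (by rw [ha0]; omega)
      · intro ν hν
        rw [shiftZ_apply_of_ne _ (hsort.1 ν hν).ne']
        exact hroot ν (List.mem_cons_of_mem _ hν)

/-- ★★ `hloc`: THE TRANSPORTER DEPENDS ONLY ON THE COMB VARIABLES — `U = U'` on `combSet k` ⇒ `g_U = g_{U'}`. [cite: Balaban1985Variational, (19) p.281; Balaban1985Averaging, (8) p.19] -/
theorem combTransporter_congr {k : ℕ} (hk : k ≤ P.m + P.K) {U U' : GaugeField P 0 G}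
    (h : ∀ b ∈ (combSet k : Set (PBond P 0)), U b = U' b) : combTransporter k U = combTransporter k U' := by
  funext x
  exact pathHolZ_congr_of_eqOn_combSet hk h x (List.finRange P.d) (rootOf k x) (List.pairwise_lt_finRange P.d)
    (fun _ _ ν _ => List.mem_finRange ν) (blockIter_rootOf hk x) (fun _ _ => rfl)

/-- ★ OFF-PIVOT FREENESS (the `σ`-side half of `hstab`): a RESIDUAL gauge transformation (`w = 1` at the `k`-centres) that fixes `U` on the comb
bonds is trivial — so the residual group acts freely near any configuration as soon as it acts through the comb bonds, pivots or not.
[cite: Balaban1985Variational, (181) p.307; Balaban1985Averaging, (8) p.19] -/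
theorem eq_one_of_isResidual_of_gaugeAct_eq_on_combSet {k : ℕ} (hk : k ≤ P.m + P.K) {w : GaugeTransf P 0 G}
    (hw : ∀ y : Site P k, w (embIter k y) = 1) {U : GaugeField P 0 G}
    (hU : ∀ b ∈ (combSet k : Set (PBond P 0)), gaugeAct w U b = U b) : w = fun _ => 1 := by
  funext x
  have h1 := congrFun (combTransporter_congr hk hU) x
  rw [combTransporter_gaugeAct_of_rootTrivial k hw U x] at h1
  -- `g x · (w x)⁻¹ = g x`
  have h2 : (w x)⁻¹ = 1 := mul_left_cancel (a := combTransporter k U x) (by rw [h1, mul_one])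
  exact inv_eq_one.1 h2

end Summit.QuantumFields.YangMills.Theorems.FluctuationComparisonRegPrIntLS2BetaSignedCombKill
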